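import Summits.PneNP.PneNP.Theorems.ReslinSizeFromWidthQuadraticSemantic
import Summits.PneNP.PneNP.Theorems.ReslinSizeFromWidthWidthFromVertexExpansionBridge

/-!
# PneNP / ReslinSizeFromWidth — quadratic size–width law, part 4a: the dictionary

Helper file for the quadratic truncation of crux `ResLinSizeFromWidth` (stmt-PneNP-18932).
On a finite window `N ⊆ ℕ` of variables: the falsifying flat `falsN N C = Sol (negSys N C)` of a
linear clause (dictionary of the Bridge file of stmt-PneNP-18934), its behaviour under `insert` /
`∪` / semantic implication, `dim W (fals C) ≤ linClauseRank C`, and the first direction of the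
bridge: a Res(⊕) refutation `π` (`IsResLinRefutation`, all forms inside the window) gives a
semantic refutation `semOf N π` inside `univ` of the axiom flats of `φ`, of the same length and of
width `≤ resLinWidth π`.
-/

namespace Summit.PneNP.PneNP.Theorems

-- `Summit.PneNP.PneNP` repeats a path component by design (summit = sub-problem); silence the linter.
set_option linter.dupNamespace false

namespace ResLinSW

section Bridge

open Module Submodule Finset
open Literature.Computability.Complexity Literature.Computability.MetaComplexity
open Literature.Computability.MetaComplexity.AffSys
open Summit.PneNP.PneNP.Theorems.ResLinRank

/-! ### Appending lines to a Res(⊕) derivation -/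

/-- Appending one valid line to a Res(⊕) derivation gives a derivation. -/
theorem isResLinDerivation_append_step {φ : CNF ℕ} {π : List ResLinLine}
    (hπ : IsResLinDerivation φ π) {l : ResLinLine} (hl : IsValidResLinLine φ π l) :
    IsResLinDerivation φ (π ++ [l]) := by
  intro k hk
  rw [List.length_append, List.length_singleton] at hk
  rcases Nat.lt_succ_iff_lt_or_eq.1 hk with h | rfl
  · rw [List.take_append_of_le_length h.le, List.getElem_append_left h]
    exact hπ k h
  · rw [List.take_append_of_le_length le_rfl, List.take_length, List.getElem_append_right le_rfl]
    simpa using hl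

/-- Splitting off the last line of a Res(⊕) derivation. -/
theorem isResLinDerivation_of_append_step {φ : CNF ℕ} {π : List ResLinLine} {l : ResLinLine}
    (h : IsResLinDerivation φ (π ++ [l])) : IsResLinDerivation φ π ∧ IsValidResLinLine φ π l := by
  constructor
  · intro k hk
    have hk' : k < (π ++ [l]).length := by rw [List.length_append]; omega
    have := h k hk'
    rwa [List.take_append_of_le_length hk.le, List.getElem_append_left hk] at this
  · have hk' : π.length < (π ++ [l]).length := by simp
    have h1 := h π.length hk'
    rw [List.take_append_of_le_length le_rfl, List.take_length,
      List.getElem_append_right le_rfl] at h1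
    simpa using h1

/-! ### The window and the dictionary -/

/-- The variables occurring in (the linear forms of) the lines of `π`. -/
def piVars (π : List ResLinLine) : Finset ℕ :=
  π.foldr (fun l acc => l.clause.biUnion (fun lit => lit.1) ∪ acc) ∅

/-- The variables occurring in `φ`. -/
def cnfVars (φ : CNF ℕ) : Finset ℕ :=
  φ.foldr (fun c acc => (c.map Prod.fst).toFinset ∪ acc) ∅

/-- Forms of lines of `π` lie inside `piVars π`. -/
theorem subset_piVars {π : List ResLinLine} {l : ResLinLine} (hl : l ∈ π) {lit : LinLit}
    (hlit : lit ∈ l.clause) : lit.1 ⊆ piVars π := by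
  induction π with
  | nil => exact absurd hl List.not_mem_nil
  | cons m π ih =>
    simp only [piVars, List.foldr_cons]
    rcases List.mem_cons.1 hl with rfl | hl
    · exact (Finset.subset_biUnion_of_mem (fun lit : LinLit => lit.1) hlit).trans
        Finset.subset_union_left
    · exact (ih hl).trans Finset.subset_union_right

/-- Variables of clauses of `φ` lie inside `cnfVars φ`. -/
theorem mem_cnfVars {φ : CNF ℕ} {c : Clause ℕ} (hc : c ∈ φ) {lit : Literal ℕ} (hlit : lit ∈ c) :
    lit.1 ∈ cnfVars φ := by
  induction φ with
  | nil => exact absurd hc List.not_mem_nil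
  | cons d φ ih =>
    simp only [cnfVars, List.foldr_cons, Finset.mem_union]
    rcases List.mem_cons.1 hc with rfl | hc
    · exact Or.inl (List.mem_toFinset.2 (List.mem_map.2 ⟨lit, hlit, rfl⟩))
    · exact Or.inr (ih hc)

/-- Forms of the translated clauses of `φ` lie inside any window containing `cnfVars φ`. -/
theorem forms_toLinClause_subset {φ : CNF ℕ} {N : Finset ℕ} (hN : cnfVars φ ⊆ N) {c : Clause ℕ}
    (hc : c ∈ φ) : ∀ l ∈ Clause.toLinClause c, l.1 ⊆ N := by
  intro l hl
  rw [Clause.toLinClause, List.mem_toFinset, List.mem_map] at hl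
  obtain ⟨lit, hlit, rfl⟩ := hl
  intro x hx
  rw [Literal.toLinLit, Finset.mem_singleton] at hx
  subst hx
  exact hN (mem_cnfVars hc hlit)

variable (N : Finset ℕ)

/-- The falsifying flat of a linear clause on the window. -/
def falsN (C : LinClause) : Set (↥N → ZMod 2) := Sol (negSys N C)

/-- The equation of a linear literal on the window: `(f = b)` is FALSE iff `⟨f, z⟩ = b + 1`. -/
def eqOf (l : LinLit) : Eqn ↥N := (restrictN N (linFormVec l.1), if l.2 = true then 0 else 1)

/-- `negSys` is the image under `eqOf`. -/
theorem negSys_eq_image (C : LinClause) : negSys N C = C.image (eqOf N) := rfl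

/-- `Sol` of a system with one more equation. -/
theorem Sol_insert (p : Eqn ↥N) (Ψ : AffSys ↥N) : Sol (insert p Ψ) = hyp p ∩ Sol Ψ := by
  ext z
  simp only [mem_Sol, Finset.mem_insert, forall_eq_or_imp, Set.mem_inter_iff, mem_hyp]

/-- Falsifying flat of a clause with one more literal. -/
theorem falsN_insert (l : LinLit) (C : LinClause) : falsN N (insert l C) = hyp (eqOf N l) ∩ falsN N C := by
  rw [falsN, falsN, negSys_eq_image, negSys_eq_image, Finset.image_insert, Sol_insert]

/-- Falsifying flat of a union. -/
theorem falsN_union (C D : LinClause) : falsN N (C ∪ D) = falsN N C ∩ falsN N D := by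
  rw [falsN, falsN, falsN, negSys_eq_image, negSys_eq_image, negSys_eq_image, Finset.image_union,
    Sol_union]

/-- Falsifying flat of the empty clause. -/
theorem falsN_empty : falsN N (∅ : LinClause) = Set.univ := by
  ext z
  simp [falsN, negSys_eq_image, mem_Sol]

/-- The two literals on a form give complementary equations. -/
theorem eqOf_true_eq (f : Finset ℕ) : eqOf N (f, true) = eqOf N (f, false) + one := by
  refine Prod.ext (by simp [eqOf, one]) ?_
  show (0 : ZMod 2) = 1 + 1
  decide

/-- The falsifying set is a flat. -/
theorem isFlat_falsN (C : LinClause) : IsFlat (falsN N C) := isFlat_Sol _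

/-- Semantic weakening in the dictionary: if `C ⊨ D` then `fals D ⊆ fals C` (forms inside the
window). -/
theorem falsN_subset_of_imp {C D : LinClause} (hC : ∀ l ∈ C, l.1 ⊆ N) (hD : ∀ l ∈ D, l.1 ⊆ N)
    (himp : ∀ σ : ℕ → Bool, C.eval σ = true → D.eval σ = true) : falsN N D ⊆ falsN N C := by
  intro z hz
  have hz' : zOf N (σOf N z) ∈ Sol (negSys N D) := by rw [zOf_σOf]; exact hz
  have hD' := (zOf_mem_Sol_negSys_iff hD _).1 hz'
  have hC' : C.eval (σOf N z) = false := by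
    cases h : C.eval (σOf N z)
    · rfl
    · rw [himp _ h] at hD'; exact absurd hD' (by decide)
  have := (zOf_mem_Sol_negSys_iff hC _).2 hC'
  rwa [zOf_σOf] at this

/-- `dim W (Sol Ψ) ≤ rk ⟨L(Ψ)⟩` for a consistent system (the linear parts of the equations of
`Sol Ψ` lie in the form span, by the constancy lemma). -/
theorem finrank_W_Sol_le (Ψ : AffSys ↥N) (hne : (Sol Ψ).Nonempty) :
    finrank (ZMod 2) ↥(W (Sol Ψ)) ≤ finrank (ZMod 2) ↥(spanS Ψ) := by
  classical
  obtain ⟨z₀, hz₀⟩ := hne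
  -- the first projection, restricted to W (Sol Ψ), lands in spanS Ψ and is injective
  have hmem : ∀ θ : ↥(W (Sol Ψ)), (θ : Eqn ↥N).1 ∈ spanS Ψ := by
    intro θ
    refine mem_spanS_of_constant hz₀ fun z hz => ?_
    rw [θ.2 z hz, θ.2 z₀ hz₀]
  let f : ↥(W (Sol Ψ)) →ₗ[ZMod 2] ↥(spanS Ψ) :=
    { toFun := fun θ => ⟨(θ : Eqn ↥N).1, hmem θ⟩
      map_add' := fun θ η => by ext; simp
      map_smul' := fun c θ => by ext; simp }
  refine LinearMap.finrank_le_finrank_of_injective (f := f) fun θ η h => ?_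
  have h1 : (θ : Eqn ↥N).1 = (η : Eqn ↥N).1 := by
    simpa [f] using congrArg Subtype.val h
  exact Subtype.ext (W_eq_of_fst_eq ⟨z₀, hz₀⟩ θ.2 η.2 h1)

/-- The equations of `univ` are trivial: `W univ = ⊥`. -/
theorem W_univ : W (Set.univ : Set (↥N → ZMod 2)) = ⊥ := by
  rw [eq_bot_iff]
  intro θ hθ
  have h0 : θ.2 = 0 := by
    have := hθ 0 (Set.mem_univ _)
    rw [dotProduct_zero] at this
    exact this.symm
  have h1 : θ.1 = 0 := by
    funext v
    have := hθ (Pi.single v 1) (Set.mem_univ _)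
    rw [dotProduct_single, mul_one, h0] at this
    exact this
  rw [Submodule.mem_bot]
  exact Prod.ext h1 h0

/-- Rank of a falsifying flat: `codim univ (fals C) ≤ linClauseRank C` (nonempty case). -/
theorem codim_falsN_le (C : LinClause) (hne : (falsN N C).Nonempty) :
    codim (Set.univ : Set (↥N → ZMod 2)) (falsN N C) ≤ linClauseRank C := by
  rw [codim, W_univ, finrank_bot, Nat.sub_zero]
  exact (finrank_W_Sol_le N _ hne).trans (finrank_spanS_negSys_le N C)

/-! ### From a Res(⊕) refutation to a semantic refutation -/

/-- The axiom flats of `φ` on the window. -/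
def axiomFlats (φ : CNF ℕ) : Set (Set (↥N → ZMod 2)) :=
  {F | ∃ c ∈ φ, F = falsN N (Clause.toLinClause c)}

/-- The semantic list of a Res(⊕) derivation: falsifying flats of its lines, last line first. -/
def semOf (π : List ResLinLine) : List (Set (↥N → ZMod 2)) :=
  (π.map fun l => falsN N l.clause).reverse

/-- The semantic list of a Res(⊕) derivation (forms inside the window) is a semantic derivation. -/
theorem isDeriv_semOf {φ : CNF ℕ} : ∀ (π : List ResLinLine), IsResLinDerivation φ π →
    (∀ l ∈ π, ∀ lit ∈ l.clause, lit.1 ⊆ N) → IsDeriv (axiomFlats N φ) (semOf N π) := by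
  intro π
  induction π using List.reverseRecOn with
  | nil => intro _ _; simp [semOf, IsDeriv]
  | append_singleton π l ih =>
    intro hπ hforms
    obtain ⟨hπ', hl⟩ := isResLinDerivation_of_append_step hπ
    have hforms' : ∀ l' ∈ π, ∀ lit ∈ l'.clause, lit.1 ⊆ N :=
      fun l' hl' => hforms l' (List.mem_append_left _ hl')
    have hsem : semOf N (π ++ [l]) = falsN N l.clause :: semOf N π := by
      simp [semOf, List.map_append]
    rw [hsem]
    refine ⟨?_, ih hπ' hforms'⟩
    -- justification of the last line
    have hmemT : ∀ i (hi : i < π.length), falsN N (π[i]'hi).clause ∈ semOf N π := by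
      intro i hi
      rw [semOf, List.mem_reverse, List.mem_map]
      exact ⟨π[i], List.getElem_mem hi, rfl⟩
    have hv := hl
    unfold IsValidResLinLine at hv
    rcases hr : l.rule with _ | ⟨i, j, f⟩ | i <;> simp only [hr] at hv
    · obtain ⟨c, hc, hcl⟩ := hv
      exact Justified.ax _ ⟨c, hc, rfl⟩ (by rw [hcl])
    · obtain ⟨hi, hj, C, D, hC, hD, hcl⟩ := hv
      refine Justified.split (eqOf N (f, false)) _ _ (hmemT i hi) (hmemT j hj) ?_ ?_
      · rw [hcl, hC, falsN_union, falsN_insert]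
        intro z hz
        exact ⟨hz.2, hz.1.1⟩
      · rw [hcl, hD, falsN_union, falsN_insert, ← eqOf_true_eq]
        intro z hz
        exact ⟨hz.2, hz.1.2⟩
    · obtain ⟨hi, himp⟩ := hv
      refine Justified.weaken (hmemT i hi) ?_
      exact falsN_subset_of_imp N (hforms' _ (List.getElem_mem hi))
        (hforms l (List.mem_append_right _ (List.mem_singleton_self _))) himp

/-- **A Res(⊕) refutation is a semantic refutation** inside `univ` of the axiom flats (on a
window containing all variables of its lines), of the same length. -/
theorem isRef_semOf {φ : CNF ℕ} {π : List ResLinLine} (hπ : IsResLinRefutation φ π)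
    (hN : ∀ l ∈ π, ∀ lit ∈ l.clause, lit.1 ⊆ N) :
    IsRef (axiomFlats N φ) Set.univ (semOf N π) := by
  refine ⟨isDeriv_semOf N π hπ.1 hN, ?_, fun _ _ => Set.subset_univ _, ?_⟩
  · obtain ⟨l, hl, hl0⟩ := hπ.2
    rw [semOf, List.mem_reverse, List.mem_map]
    exact ⟨l, hl, by rw [hl0, falsN_empty]⟩
  · intro S hS
    rw [semOf, List.mem_reverse, List.mem_map] at hS
    obtain ⟨l, -, rfl⟩ := hS
    exact isFlat_falsN N _

/-- The semantic list has the same length. -/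
theorem length_semOf (π : List ResLinLine) : (semOf N π).length = π.length := by
  simp [semOf]

/-- The semantic width is at most the rank-width of the refutation. -/
theorem width_semOf_le (π : List ResLinLine) : width Set.univ (semOf N π) ≤ resLinWidth π := by
  rw [width_le_iff]
  intro S hS hne
  rw [semOf, List.mem_reverse, List.mem_map] at hS
  obtain ⟨l, hl, rfl⟩ := hS
  exact (codim_falsN_le N l.clause hne).trans (linClauseRank_le_resLinWidth hl)

end Bridge

end ResLinSW

end Summit.PneNP.PneNP.Theorems
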